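import Literature.AlgebraicGeometry.Modules.SyzygyLocallyFreeOfRegularNoetherian
import Literature.AlgebraicGeometry.Modules.StrictlyPerfectResolutionOfRegular
import HarnessLib

/-!
# Finite locally free resolutions on a NOETHERIAN regular scheme with the resolution property — no dimension bound
# (Hartshorne III Ex. 6.9 (a); Görtz–Wedhorn II, Prop. 23.55)

Layer `Literature/AlgebraicGeometry/Modules` (0 named facts, no definitions, no instances, no notation).
Sequel to `Modules/StrictlyPerfectResolutionOfRegular`, whose assembly
`nonempty_strictlyPerfectResolution_of_coh_of_isRegular` takes, besides the resolution property and
regularity, a bound `hdim : ∀ x, dim 𝒪_{X,x} ≤ d` on the stalks. Hartshorne III Ex. 6.9 (a) is stated for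
"`X` noetherian, integral, separated, regular" with no such bound, and a noetherian regular scheme may have
stalks of unbounded dimension (Nagata). This file re-runs the same assembly (the K-phase `kPhase_iter` of
that file, then attaching the frontier kernel) with the termination step taken from
`Modules/SyzygyLocallyFreeOfRegularNoetherian.exists_isFiniteLocallyFree_kernel_of_isRegular`, which needs only
`X` noetherian and regular (the number of steps is the finite projective dimension of the sections of `F` on a
finite affine cover, `Modules/ProjectiveDimensionFiniteOfRegular`):

* **`nonempty_strictlyPerfectResolution_of_coh_of_isRegular_of_isNoetherian`** — on a noetherian scheme
  with the resolution property (every coherent module is a quotient of a finite locally free one) all of whose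
  stalks are regular local rings, every coherent `𝒪_X`-module has a strictly perfect resolution
  (`Modules/StrictlyPerfectResolution`);
* `IsProjectiveOver.nonempty_strictlyPerfectResolution_of_coh_of_isRegular'` — in particular on every
  projective REGULAR scheme over a field (resolution property: `Modules/ResolutionPropertyProjective`,
  Hartshorne II Cor. 5.18), without the dimension hypothesis of
  `Modules/BoundedCoherentVBModelsProjective.IsProjectiveOver.nonempty_strictlyPerfectResolution_of_coh_of_isRegular`.

With Kleiman's theorem (the resolution property of noetherian integral separated regular schemes,
Hartshorne II Ex. 6.8) the first theorem is Hartshorne III Ex. 6.9 (a) as stated; that input is not in this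
file. Everything is proved; `Modules/StrictlyPerfectResolutionOfRegular` is unchanged (its §2 proof is
repeated here with the new termination step).

## References

* R. Hartshorne, *Algebraic Geometry*, GTM 52 (1977): II Cor. 5.18, III Ex. 6.8, Ex. 6.9 (a) (p. 238).
  [Hartshorne1977]
* W. Fulton, *Intersection Theory*, 2nd ed. (1998), App. B.8.3 (i)–(ii). [Fulton1998]
* U. Görtz, T. Wedhorn, *Algebraic Geometry II* (2023), Prop. 23.55, Remark 23.56. [GortzWedhorn2023]
-/

noncomputable section

universe u

open CategoryTheory CategoryTheory.Limits AlgebraicGeometry TopologicalSpace Opposite ZeroObject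
open HomologicalComplex CochainComplex

namespace Literature.AlgebraicGeometry.Modules

open Literature.AlgebraicGeometry.Morphisms Literature.AlgebraicGeometry.Motives
  Literature.AlgebraicGeometry.KTheory Literature.AlgebraicGeometry.KTheory.Adapted
  Literature.Algebra.Homology.AttachCell Literature.AlgebraicGeometry.Resolution

/-! ### §1 Noetherian regular schemes with the resolution property -/

section Regular

variable {X : Scheme.{u}} [IsNoetherian X]

/-- **Hartshorne III Ex. 6.9 (a) ∕ Görtz–Wedhorn II Prop. 23.55 for single sheaves, with the resolution
property as input and NO dimension bound.** Let `X` be a noetherian scheme with the resolution property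
(every coherent module is a quotient of a finite locally free one) all of whose local rings are regular
(`Resolution.Scheme.IsRegular`). Then every coherent `𝒪_X`-module `F` has a strictly perfect resolution: with
`d` the exponent of `exists_isFiniteLocallyFree_kernel_of_isRegular` for `F`, run the K-phase `d` steps
(`kPhase_iter`), so that the frontier kernel `G = ker(dᶠ)`, `f = -1 - d`, is finite locally free, and attach
`G` itself in degree `f - 1` (exact at `f` since `G ↠ ker dᶠ`, at `f - 1` since `G ↪ Qᶠ`, zero below).
[cite: Hartshorne1977, III Ex. 6.9 (a) (p. 238)] [cite: GortzWedhorn2023, Prop. 23.55] -/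
theorem nonempty_strictlyPerfectResolution_of_coh_of_isRegular_of_isNoetherian
    (hquot : ∀ G : X.Modules, Coh G → ∃ (E : X.Modules) (p : E ⟶ G), IsFiniteLocallyFree E ∧ Epi p)
    (hreg : Scheme.IsRegular X) {F : X.Modules} (hF : Coh F) : Nonempty (StrictlyPerfectResolution F) := by
  obtain ⟨d, hd⟩ := exists_isFiniteLocallyFree_kernel_of_isRegular hreg hF
  obtain ⟨Q, β, hQ, hLE, hqi, hzero⟩ := kPhase_iter hquot hF d
  haveI := hLE
  -- the frontier `f = -1 - d` and its kernel `G`, finite locally free by the choice of `d`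
  set f : ℤ := -1 - (d : ℤ) with hfdef
  have hf0 : f < 0 := by omega
  have hG : IsFiniteLocallyFree (kernel (Q.d f (f + 1))) :=
    hd Q hQ.isFiniteLocallyFree (Q.isZero_of_isStrictlyLE 0 1 (by omega)) β f hqi hf0 (by omega)
  -- attach `G` itself in degree `f - 1`
  let ψ₀ : kernel (Q.d f (f + 1)) ⟶ Q.X f := kernel.ι (Q.d f (f + 1))
  have hψ : ψ₀ ≫ Q.d f (f + 1) = 0 := kernel.condition _
  haveI : Epi (kernel.lift (Q.d f (f + 1)) ψ₀ hψ) := by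
    have : kernel.lift (Q.d f (f + 1)) ψ₀ hψ = 𝟙 _ := by
      rw [← cancel_mono (kernel.ι (Q.d f (f + 1))), kernel.lift_ι, Category.id_comp]
    rw [this]
    infer_instance
  let P : CochainComplex X.Modules ℤ := attach ψ₀ hψ
  let ε : P ⟶ (single X.Modules (ComplexShape.up ℤ) 0).obj F :=
    descOfCompEqZero _ β (fromSingle_comp_eq_zero ψ₀ hψ β (by omega))
  haveI hPLE : P.IsStrictlyLE 0 := isStrictlyLE_attach ψ₀ hψ 0 (by omega)
  have hP : IsBoundedVBComplex P := (IsBoundedVBComplex.single _ hG f).mappingCone hQ _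
  -- `ε` is a quasi-isomorphism in every degree
  have hε : ∀ i : ℤ, QuasiIsoAt ε i := by
    intro i
    rcases lt_trichotomy i (f - 1) with hlt | rfl | hgt
    · -- below `f - 1`: both sides vanish
      rw [quasiIsoAt_iff_exactAt' _ i (exactAt_single_obj _ _ _ _ (by omega))]
      exact (P.exactAt_iff i).2 (ShortComplex.exact_of_isZero_X₂ _
        (isZero_attach_X ψ₀ hψ i (by omega) (hzero i (by omega))))
    · -- degree `f - 1`: `P^{f-2} = 0` and `P^{f-1} = G ↪ Qᶠ`
      rw [quasiIsoAt_iff_exactAt' _ (f - 1) (exactAt_single_obj _ _ _ _ (by omega)),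
        P.exactAt_iff' (f - 1 - 1) (f - 1) f (by simp) (by simp)]
      have hz : IsZero (P.X (f - 1 - 1)) := isZero_attach_X ψ₀ hψ (f - 1 - 1) (by omega) (hzero _ (by omega))
      refine (ShortComplex.exact_iff_mono _ (hz.eq_of_src _ _)).2 ?_
      -- `d^{f-1} = ιE⁻¹ ≫ ψ₀ ≫ inrᶠ` is a monomorphism
      have hca : f - 1 + 1 = f := by omega
      have hιiso : IsIso (ιE ψ₀ hψ (f - 1) hca) := isIso_ιE ψ₀ hψ (f - 1) hca (hzero _ (by omega))
      have hmono₁ : Mono (inv (ιE ψ₀ hψ (f - 1) hca)) :=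
        @IsIso.mono_of_iso _ _ _ _ _ (@IsIso.inv_isIso _ _ _ _ _ hιiso)
      have hmono₂ : Mono (ψ₀ ≫ (mappingCone.inr (fromSingle ψ₀ hψ)).f f) :=
        @mono_comp _ _ _ _ _ ψ₀ (by simp only [ψ₀]; infer_instance) _ (mono_inr_f _ _)
      have hd' : (P.sc' (f - 1 - 1) (f - 1) f).g =
          inv (ιE ψ₀ hψ (f - 1) hca) ≫ (ψ₀ ≫ (mappingCone.inr (fromSingle ψ₀ hψ)).f f) := by
        rw [← ιE_d ψ₀ hψ (f - 1) hca, IsIso.inv_hom_id_assoc]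
        rfl
      rw [hd']
      exact @mono_comp _ _ _ _ _ _ hmono₁ _ hmono₂
    · rcases eq_or_lt_of_le (show f ≤ i by omega) with rfl | hlt
      · -- degree `f`: `G ↠ ker dᶠ`
        rw [quasiIsoAt_iff_exactAt' _ f (exactAt_single_obj _ _ _ _ (by omega))]
        exact exactAt_attach ψ₀ hψ (c := f - 1) (by omega) rfl hψ
      · -- above `f`: unchanged
        exact (quasiIsoAt_descOfCompEqZero_iff _ β _ i
          (isZero_single_X (a := f) (E := kernel (Q.d f (f + 1))) i (by omega))
          (isZero_single_X (a := f) (E := kernel (Q.d f (f + 1))) (i + 1) (by omega))).2 (hqi i hlt)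
  exact ⟨{ P := P, isBoundedVB := hP, isStrictlyLE := hPLE, ε := ε, quasiIso := by exact (quasiIso_iff _).2 hε }⟩

end Regular

/-! ### §2 Projective regular schemes over a field (no dimension hypothesis) -/

section Projective

variable {k : Type u} [Field k] {Y : SchemeOver k}

/-- **Every coherent sheaf on a projective regular `k`-scheme has a finite locally free resolution** — the
resolution property is Hartshorne II Cor. 5.18 (`ResolutionPropertyProjective.IsProjectiveOver.exists_isFiniteLocallyFree_epi_of_coh`),
the scheme is noetherian (of finite type over a field), termination by §1; no bound on the dimension of the
local rings is assumed (contrast `IsProjectiveOver.nonempty_strictlyPerfectResolution_of_coh_of_isRegular`).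
[cite: Hartshorne1977, III Ex. 6.9 (a) (p. 238) with II Cor. 5.18] [cite: GortzWedhorn2023, Prop. 23.55] -/
theorem IsProjectiveOver.nonempty_strictlyPerfectResolution_of_coh_of_isRegular' (hY : IsProjectiveOver Y)
    (hreg : Scheme.IsRegular Y.left) {F : Y.left.Modules} (hF : Coh F) :
    Nonempty (StrictlyPerfectResolution F) := by
  haveI : IsProper Y.hom := hY.isProper
  haveI : IsNoetherian Y.left := by
    haveI : LocallyOfFiniteType Y.hom := inferInstance
    haveI : IsLocallyNoetherian Y.left := LocallyOfFiniteType.isLocallyNoetherian Y.hom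
    haveI : QuasiCompact Y.hom := inferInstance
    haveI : CompactSpace Y.left := QuasiCompact.compactSpace_of_compactSpace Y.hom
    exact {}
  exact nonempty_strictlyPerfectResolution_of_coh_of_isRegular_of_isNoetherian
    (fun G hG => IsProjectiveOver.exists_isFiniteLocallyFree_epi_of_coh hY hG) hreg hF

end Projective

end Literature.AlgebraicGeometry.Modules

end
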